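import Summits.Ventures.DiscreteObjects.PP12.FixedPointCongruences

/-!
# STD₂[12;6]: an automorphism of order 5 has class-orbit type (5,5,1,1)² with one fixed element per fixed class (P5 reduction, kernel)
Framing: lottery ticket; floor = certified bounds/negative ranges.

Cell pub-namedobj (target M), family P5 of the STD₂[12;6] automorphism census (designs g6, FAMILY-P5.md §1). A symmetric
transversal design STD_λ[k;u] is stored as an INCIDENCE ARRAY `π : Fin k → Fin k → Perm (Fin u)`: the point `(i,a)` of point
class `i` lies on the block `(j, π i j a)` of block class `j` (every point is on exactly one block of every block class and every
block carries exactly one point of every point class, so the array is faithful); `IsSTD lam π` says that two points of different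
classes lie on exactly `lam` common blocks and two blocks of different classes meet in exactly `lam` points. An automorphism in
array form (`ArrayAut`) is a permutation `σ` of the point classes with label bijections `α i` (class `i` → class `σ i`), a
permutation `ρ` of the block classes with label bijections `β j`, transporting incidence (`map_inc`).

`order_five_reduction`: for an STD₂[12;6] and an array automorphism `τ` with `σ⁵ = 1`, `ρ⁵ = 1`, `(β j)⁵ = 1` on every fixed
block class (consequences of `τ⁵ = id`; `(α i)⁵ = 1` is then automatic and not assumed) and `τ ≠ id` on points, the permutation `σ`
fixes EXACTLY TWO point classes, `ρ` fixes exactly two block classes, and on each fixed class the label permutation has EXACTLY ONE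
fixed label (so, its order dividing 5, it is a 5-cycle on the other five). Steps (FAMILY-P5 §1): fixed classes number 2, 7 or 12
and fixed labels 1 or 6 (`fixedCard_modEq`, Mathlib's cycle count); a fixed point class and a fixed block class carry conjugate
label permutations (`fixedCard_alpha_eq_beta`); if the fixed labels number 6, the orbit of a moved point lies on the fixed block
through it of each of two fixed block classes, which then meet in ≥ 5 > 2 points (`no_identity_type`); if they number 1, every
fixed block contains every fixed point, so two fixed blocks (resp. points) force ≤ 2 fixed point (resp. block) classes.
This is the lemma that reduces the census cell 'automorphism of order 5' to ONE τ-reduced array shape, searched exhaustively by two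
independent engines (HOME/code/std6, FAMILY-P5 §4–§6: no STD₂[12;6] admits an automorphism of order 5). The search itself is NOT
formalised here. Design choice: array form with class-preserving maps — an abstract isomorphism of STDs preserves the classes
(two points are in one class iff they share no block, λ = 2 > 0), so nothing is lost; non-triviality is asked on points only
(`hne`); a block-only non-trivial automorphism is impossible since a block is determined by its 12 points.
-/

namespace Summit.Ventures.DiscreteObjects.STD

open Finset Equiv Summit.Ventures.DiscreteObjects.PP12

/-- Incidence array of a square class-divided structure with `k` point classes and `k` block classes of size `u`:
the point `(i, a)` lies on the block `(j, π i j a)`. -/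
abbrev IncArray (k u : ℕ) := Fin k → Fin k → Perm (Fin u)

variable {k u : ℕ}

/-- The STD_λ[k;u] axioms in array form: two points of different classes lie on exactly `lam` common blocks
(`π i j a = π i' j b` says that block `(j, ·)` is common), and dually two blocks of different classes have exactly `lam`
common points. (Points of one class share no block and blocks of one class are disjoint automatically.) -/
def IsSTD (lam : ℕ) (π : IncArray k u) : Prop :=
  (∀ i i' : Fin k, i ≠ i' → ∀ a b : Fin u, (univ.filter fun j => π i j a = π i' j b).card = lam) ∧
  (∀ j j' : Fin k, j ≠ j' → ∀ c d : Fin u, (univ.filter fun i => (π i j).symm c = (π i j').symm d).card = lam)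

/-- An automorphism of the incidence array: `σ` permutes the point classes and `α i : Fin u ≃ Fin u` carries the labels of
class `i` to those of class `σ i`; `ρ`, `β` likewise for blocks; incidence is transported: the image `(σ i, α i a)` of the
point `(i,a)` lies on the image `(ρ j, β j (π i j a))` of the block `(j, π i j a)`. -/
structure ArrayAut (π : IncArray k u) where
  /-- permutation of the point classes -/
  σ : Perm (Fin k)
  /-- label maps on point classes -/
  α : Fin k → Perm (Fin u)
  /-- permutation of the block classes -/
  ρ : Perm (Fin k)
  /-- label maps on block classes -/
  β : Fin k → Perm (Fin u)
  /-- incidence is transported -/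
  map_inc : ∀ i j a, π (σ i) (ρ j) (α i a) = β j (π i j a)

section PermFacts

variable {n : ℕ}

/-- `fixedCard` is at most the size of the set. -/
theorem fixedCard_le (τ : Perm (Fin n)) : fixedCard τ ≤ n := by
  unfold fixedCard
  exact (card_le_univ _).trans (by simp)

/-- All points fixed means the permutation is the identity. -/
theorem eq_one_of_fixedCard_eq (τ : Perm (Fin n)) (h : fixedCard τ = n) : τ = 1 := by
  unfold fixedCard at h
  have hs : (univ.filter fun x => τ x = x) = univ := by
    apply eq_univ_of_card
    simpa using h
  refine Equiv.ext fun x => ?_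
  have hx : x ∈ univ.filter fun x => τ x = x := by rw [hs]; exact mem_univ x
  simpa using (mem_filter.mp hx).2

/-- A permutation of `Fin 12` with `σ⁵ = 1` fixes 2, 7 or 12 points. -/
theorem fixedCard_twelve_of_pow_five {σ : Perm (Fin 12)} (hσ : σ ^ 5 = 1) :
    fixedCard σ = 2 ∨ fixedCard σ = 7 ∨ fixedCard σ = 12 := by
  haveI : Fact (Nat.Prime 5) := ⟨by norm_num⟩
  have h1 := fixedCard_modEq hσ
  have h2 := fixedCard_le σ
  simp only [Fintype.card_fin] at h1
  unfold Nat.ModEq at h1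
  omega

/-- A permutation of `Fin 6` with `α⁵ = 1` fixes 1 or 6 points. -/
theorem fixedCard_six_of_pow_five {α : Perm (Fin 6)} (hα : α ^ 5 = 1) :
    fixedCard α = 1 ∨ fixedCard α = 6 := by
  haveI : Fact (Nat.Prime 5) := ⟨by norm_num⟩
  have h1 := fixedCard_modEq hα
  have h2 := fixedCard_le α
  simp only [Fintype.card_fin] at h1
  unfold Nat.ModEq at h1
  omega

/-- If `σ⁵ = 1` and `σᵈ y = y` for some `0 < d < 5` then `σ y = y`. -/
theorem fixed_of_pow_fixed {σ : Perm (Fin n)} (hσ : σ ^ 5 = 1) {d : ℕ} (hd0 : 0 < d) (hd5 : d < 5) {y : Fin n}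
    (h : (σ ^ d) y = y) : σ y = y := by
  have h5 : (σ ^ 5) y = y := by rw [hσ]; rfl
  interval_cases d
  · simpa using h
  · -- d = 2
    have h4 : (σ ^ 4) y = y := by
      rw [show (4 : ℕ) = 2 + 2 from rfl, pow_add, Perm.mul_apply, h, h]
    have : (σ ^ 5) y = σ y := by
      rw [show (5 : ℕ) = 1 + 4 from rfl, pow_add, Perm.mul_apply, h4, pow_one]
    rw [this] at h5; exact h5
  · -- d = 3
    have h6 : (σ ^ 6) y = y := by
      rw [show (6 : ℕ) = 3 + 3 from rfl, pow_add, Perm.mul_apply, h, h]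
    have : (σ ^ 6) y = σ y := by
      rw [show (6 : ℕ) = 1 + 5 from rfl, pow_add, Perm.mul_apply, h5, pow_one]
    rw [this] at h6; exact h6
  · -- d = 4
    have h8 : (σ ^ 8) y = y := by
      rw [show (8 : ℕ) = 4 + 4 from rfl, pow_add, Perm.mul_apply, h, h]
    have h3 : (σ ^ 3) y = y := by
      have : (σ ^ 8) y = (σ ^ 3) y := by
        rw [show (8 : ℕ) = 3 + 5 from rfl, pow_add, Perm.mul_apply, h5]
      rw [this] at h8; exact h8
    have h6 : (σ ^ 6) y = y := by
      rw [show (6 : ℕ) = 3 + 3 from rfl, pow_add, Perm.mul_apply, h3, h3]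
    have : (σ ^ 6) y = σ y := by
      rw [show (6 : ℕ) = 1 + 5 from rfl, pow_add, Perm.mul_apply, h5, pow_one]
    rw [this] at h6; exact h6

/-- If `σ⁵ = 1` and `σ i ≠ i`, the five classes `σᵐ i`, `m < 5`, are pairwise distinct. -/
theorem pow_apply_injective {σ : Perm (Fin n)} (hσ : σ ^ 5 = 1) {i : Fin n} (hi : σ i ≠ i) :
    Function.Injective fun m : Fin 5 => (σ ^ (m : ℕ)) i := by
  intro m m' hmm
  simp only at hmm
  by_contra hne
  -- w.l.o.g. order the exponents
  rcases lt_or_gt_of_ne (fun h : (m : ℕ) = m' => hne (Fin.ext h)) with hlt | hlt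
  · -- (σ^(m'-m)) fixes y := σ^m i
    have hd : (σ ^ ((m' : ℕ) - m)) ((σ ^ (m : ℕ)) i) = (σ ^ (m : ℕ)) i := by
      rw [← Perm.mul_apply, ← pow_add, Nat.sub_add_cancel hlt.le, ← hmm]
    have hy := fixed_of_pow_fixed hσ (Nat.sub_pos_of_lt hlt) (by omega) hd
    apply hi
    have : (σ ^ (m : ℕ)) (σ i) = (σ ^ (m : ℕ)) i := by
      rw [← Perm.mul_apply, ← pow_succ, pow_succ', Perm.mul_apply, hy]
    exact (σ ^ (m : ℕ)).injective this
  · have hd : (σ ^ ((m : ℕ) - m')) ((σ ^ (m' : ℕ)) i) = (σ ^ (m' : ℕ)) i := by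
      rw [← Perm.mul_apply, ← pow_add, Nat.sub_add_cancel hlt.le, hmm]
    have hy := fixed_of_pow_fixed hσ (Nat.sub_pos_of_lt hlt) (by omega) hd
    apply hi
    have : (σ ^ (m' : ℕ)) (σ i) = (σ ^ (m' : ℕ)) i := by
      rw [← Perm.mul_apply, ← pow_succ, pow_succ', Perm.mul_apply, hy]
    exact (σ ^ (m' : ℕ)).injective this

/-- Two distinct fixed points from `2 ≤ fixedCard`. -/
theorem two_fixed_of_le {τ : Perm (Fin n)} (h : 2 ≤ fixedCard τ) : ∃ x y, x ≠ y ∧ τ x = x ∧ τ y = y := by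
  unfold fixedCard at h
  obtain ⟨x, y, hx, hy, hxy⟩ := one_lt_card_iff.mp h
  simp only [mem_filter, mem_univ, true_and] at hx hy
  exact ⟨x, y, hxy, hx, hy⟩

/-- The unique fixed point from `fixedCard = 1`. -/
theorem fixed_unique_of_eq_one {τ : Perm (Fin n)} (h : fixedCard τ = 1) :
    ∃ x, τ x = x ∧ ∀ y, τ y = y → y = x := by
  unfold fixedCard at h
  obtain ⟨x, hx⟩ := card_eq_one.mp h
  refine ⟨x, ?_, fun y hy => ?_⟩
  · have : x ∈ univ.filter fun z => τ z = z := by rw [hx]; exact mem_singleton_self x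
    simpa using (mem_filter.mp this).2
  · have : y ∈ univ.filter fun z => τ z = z := by simp [hy]
    rw [hx] at this
    exact mem_singleton.mp this

end PermFacts

section Reduction

variable (π : IncArray 12 6) (τ : ArrayAut π)

/-- Equivariance on a fixed pair of classes: the label permutations of a fixed point class and a fixed block class are
conjugate by `π i j`, so they have the same number of fixed labels. -/
theorem fixedCard_alpha_eq_beta {i j : Fin 12} (hi : τ.σ i = i) (hj : τ.ρ j = j) :
    fixedCard (τ.α i) = fixedCard (τ.β j) := by
  unfold fixedCard
  refine card_bij (fun a _ => π i j a) (fun a ha => ?_) (fun a _ b _ h => (π i j).injective h) (fun c hc => ?_)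
  · simp only [mem_filter, mem_univ, true_and] at ha ⊢
    have h := τ.map_inc i j a
    rw [hi, hj, ha] at h
    exact h.symm
  · simp only [mem_filter, mem_univ, true_and] at hc
    refine ⟨(π i j).symm c, ?_, by simp⟩
    simp only [mem_filter, mem_univ, true_and]
    have h := τ.map_inc i j ((π i j).symm c)
    rw [hi, hj, Equiv.apply_symm_apply, hc] at h
    exact (π i j).injective (by rw [h, Equiv.apply_symm_apply])

/-- The 'identity type' is impossible: if two distinct fixed block classes have trivial label permutations and some point class is
moved, two blocks of different classes share the 5 points of an orbit. -/
theorem no_identity_type (hπ : IsSTD 2 π) (hσ : τ.σ ^ 5 = 1) {j₁ j₂ : Fin 12} (hj : j₁ ≠ j₂) (hj₁ : τ.ρ j₁ = j₁)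
    (hj₂ : τ.ρ j₂ = j₂) (hb₁ : τ.β j₁ = 1) (hb₂ : τ.β j₂ = 1) {i : Fin 12} (hi : τ.σ i ≠ i) : False := by
  -- the orbit of the point (i, 0): labels aSeq m in class σ^m i
  let aSeq : ℕ → Fin 6 := fun m => Nat.rec (0 : Fin 6) (fun m a => τ.α ((τ.σ ^ m) i) a) m
  have aSeq_succ : ∀ m, aSeq (m + 1) = τ.α ((τ.σ ^ m) i) (aSeq m) := fun m => rfl
  have aSeq_zero : aSeq 0 = 0 := rfl
  -- both fixed blocks through (i,0) contain the whole orbit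
  have key : ∀ (j : Fin 12), τ.ρ j = j → τ.β j = 1 →
      ∀ m : ℕ, π ((τ.σ ^ m) i) j (aSeq m) = π i j 0 := by
    intro j hjf hbj m
    induction m with
    | zero => simp [aSeq_zero]
    | succ m ih =>
      rw [aSeq_succ, pow_succ', Perm.mul_apply]
      have h := τ.map_inc ((τ.σ ^ m) i) j (aSeq m)
      rw [hjf, hbj, ih] at h
      simpa using h
  -- the dual count for the blocks (j₁, π i j₁ 0) and (j₂, π i j₂ 0)
  have hcount := hπ.2 j₁ j₂ hj (π i j₁ 0) (π i j₂ 0)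
  have hsub : (univ.image fun m : Fin 5 => (τ.σ ^ (m : ℕ)) i) ⊆
      univ.filter (fun i' => (π i' j₁).symm (π i j₁ 0) = (π i' j₂).symm (π i j₂ 0)) := by
    intro i' hi'
    obtain ⟨m, -, rfl⟩ := mem_image.mp hi'
    simp only [mem_filter, mem_univ, true_and]
    rw [← key j₁ hj₁ hb₁ m, ← key j₂ hj₂ hb₂ m, Equiv.symm_apply_apply, Equiv.symm_apply_apply]
  have hcard : (univ.image fun m : Fin 5 => (τ.σ ^ (m : ℕ)) i).card = 5 := by
    rw [card_image_of_injective _ (pow_apply_injective hσ hi)]; simp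
  have := card_le_card hsub
  rw [hcard, hcount] at this
  omega

/-- **P5 reduction lemma** (FAMILY-P5 §1). For an STD₂[12;6] in array form and an array automorphism of order 5
(`σ⁵ = 1`, `ρ⁵ = 1`, `(β j)⁵ = 1` on every fixed block class — all consequences of `τ⁵ = id`; the corresponding hypothesis
on the `α i` is not needed, it follows by conjugacy — and not the identity on points): exactly two point classes and two
block classes are fixed, and each fixed class carries exactly one fixed label. -/
theorem order_five_reduction (hπ : IsSTD 2 π) (hσ : τ.σ ^ 5 = 1) (hρ : τ.ρ ^ 5 = 1)
    (hβ : ∀ j, τ.ρ j = j → τ.β j ^ 5 = 1) (hne : ¬ (τ.σ = 1 ∧ ∀ i, τ.α i = 1)) :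
    fixedCard τ.σ = 2 ∧ fixedCard τ.ρ = 2 ∧
      (∀ i, τ.σ i = i → fixedCard (τ.α i) = 1) ∧ (∀ j, τ.ρ j = j → fixedCard (τ.β j) = 1) := by
  have hP := fixedCard_twelve_of_pow_five hσ
  have hB := fixedCard_twelve_of_pow_five hρ
  obtain ⟨j₁, j₂, hj, hj₁, hj₂⟩ := two_fixed_of_le (τ := τ.ρ) (by omega)
  obtain ⟨i₁, i₂, hi, hi₁, hi₂⟩ := two_fixed_of_le (τ := τ.σ) (by omega)
  -- all fixed classes carry the same number n of fixed labels
  have hAll_α : ∀ i, τ.σ i = i → fixedCard (τ.α i) = fixedCard (τ.β j₁) := fun i h => fixedCard_alpha_eq_beta π τ h hj₁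
  have hAll_β : ∀ j, τ.ρ j = j → fixedCard (τ.β j) = fixedCard (τ.β j₁) := fun j h =>
    (fixedCard_alpha_eq_beta π τ hi₁ h).symm.trans (fixedCard_alpha_eq_beta π τ hi₁ hj₁)
  rcases fixedCard_six_of_pow_five (hβ j₁ hj₁) with h1 | h6
  · -- one fixed label everywhere
    have hαone : ∀ i, τ.σ i = i → fixedCard (τ.α i) = 1 := fun i h => (hAll_α i h).trans h1
    have hβone : ∀ j, τ.ρ j = j → fixedCard (τ.β j) = 1 := fun j h => (hAll_β j h).trans h1
    -- every fixed block contains every fixed point: for fixed i, j the β j-fixed label is π i j (the α i-fixed label)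
    have inc : ∀ i j, τ.σ i = i → τ.ρ j = j → ∀ a c, τ.α i a = a → τ.β j c = c → π i j a = c := by
      intro i j hif hjf a c ha hc
      obtain ⟨c0, -, huniq⟩ := fixed_unique_of_eq_one (hβone j hjf)
      have h := τ.map_inc i j a
      rw [hif, hjf, ha] at h
      rw [huniq _ h.symm, huniq _ hc]
    refine ⟨?_, ?_, hαone, hβone⟩
    · -- two fixed blocks share all fixed points ⇒ ≤ 2 fixed point classes
      obtain ⟨c₁, hc₁, -⟩ := fixed_unique_of_eq_one (hβone j₁ hj₁)
      obtain ⟨c₂, hc₂, -⟩ := fixed_unique_of_eq_one (hβone j₂ hj₂)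
      have hsub : (univ.filter fun i => τ.σ i = i) ⊆
          univ.filter (fun i' => (π i' j₁).symm c₁ = (π i' j₂).symm c₂) := by
        intro i' hi'
        simp only [mem_filter, mem_univ, true_and] at hi' ⊢
        obtain ⟨a, ha, -⟩ := fixed_unique_of_eq_one (hαone i' hi')
        rw [← inc i' j₁ hi' hj₁ a c₁ ha hc₁, ← inc i' j₂ hi' hj₂ a c₂ ha hc₂, Equiv.symm_apply_apply,
          Equiv.symm_apply_apply]
      have h := card_le_card hsub
      rw [hπ.2 j₁ j₂ hj c₁ c₂] at h
      change fixedCard τ.σ ≤ 2 at h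
      omega
    · obtain ⟨a₁, ha₁, -⟩ := fixed_unique_of_eq_one (hαone i₁ hi₁)
      obtain ⟨a₂, ha₂, -⟩ := fixed_unique_of_eq_one (hαone i₂ hi₂)
      have hsub : (univ.filter fun j => τ.ρ j = j) ⊆ univ.filter (fun j => π i₁ j a₁ = π i₂ j a₂) := by
        intro j hj'
        simp only [mem_filter, mem_univ, true_and] at hj' ⊢
        obtain ⟨c, hc, -⟩ := fixed_unique_of_eq_one (hβone j hj')
        rw [inc i₁ j hi₁ hj' a₁ c ha₁ hc, inc i₂ j hi₂ hj' a₂ c ha₂ hc]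
      have h := card_le_card hsub
      rw [hπ.1 i₁ i₂ hi a₁ a₂] at h
      change fixedCard τ.ρ ≤ 2 at h
      omega
  · -- six fixed labels on every fixed class: the identity type
    exfalso
    have hb₁ : τ.β j₁ = 1 := eq_one_of_fixedCard_eq _ h6
    have hb₂ : τ.β j₂ = 1 := eq_one_of_fixedCard_eq _ ((hAll_β j₂ hj₂).trans h6)
    by_cases hs : τ.σ = 1
    · apply hne
      refine ⟨hs, fun i => eq_one_of_fixedCard_eq _ ?_⟩
      exact (hAll_α i (by rw [hs]; rfl)).trans h6
    · have : ∃ i, τ.σ i ≠ i := by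
        by_contra h
        push Not at h
        exact hs (Equiv.ext h)
      obtain ⟨i, hi⟩ := this
      exact no_identity_type π τ hπ hσ hj hj₁ hj₂ hb₁ hb₂ hi

end Reduction

end Summit.Ventures.DiscreteObjects.STD
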